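import Literature.AlgebraicGeometry.HodgeTheory.GAGATwistingSheavesProjectiveSpace
import Literature.Algebra.Homology.LaurentCechFreeCohomology
import Literature.Algebra.Homology.SerreFinitenessH0
import HarnessLib

/-!
# The holomorphic Čech cohomology of `𝒪(n)^h` on `ℙ_r(ℂ)`: vanishing and finiteness

Consequences of the GAGA comparison `GAGATwist.quasiIso_cechComparison` (Serre 1956, n° 13
Lemmes 4–5 for the twisting sheaves, by Frenkel's Laurent method) combined with the tree's
algebraic computation of the Čech cohomology of the free graded module
(`LaurentCech.isZero_homology_cech_top_of_lt`, `LaurentCech.moduleFinite_homology_cech_top`;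
Serre FAC n° 65): for the HOLOMORPHIC ordered Čech complex `holCech r n` of `𝒪(n)^h` on the
standard cover of `ℙ_r(ℂ)`,

* `isIso_homologyMap_cechComparison` — `Ȟ^q(𝔘, 𝒪(n)) ≅ Ȟ^q(𝔘^h, 𝒪(n)^h)` for all `q`;
* `isZero_homology_holCech_of_lt` — `Ȟ^q(𝔘^h, 𝒪(n)^h) = 0` for `0 < q < r`;
* `isZero_homology_holCech_of_gt` — `Ȟ^q(𝔘^h, 𝒪(n)^h) = 0` for `q > r`;
* `eqOn_coordCone_of_eqOn_torus` — faithfulness of the model (`F_n(s)` IS `Γ(U_s^h, 𝒪(n)^h)`: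
  the holomorphic witness on the cone is unique, the torus being dense);
* `exists_mvPolynomial_of_d_zero_eq_zero` — Lemme 4 in cocycle form: for `r ≥ 1` every
  holomorphic `0`-cocycle of `𝒪(n)^h` is ONE homogeneous polynomial of degree `n`;
* `moduleFinite_homology_holCech` — `Ȟ^q(𝔘^h, 𝒪(n)^h)` is finite-dimensional for every `q`
  (the Cartan–Serre finiteness theorem in this instance, with no elliptic theory; degree `0` via
  `LaurentCech.moduleFinite_homology_cech_zero`).

## References
* [cite: SerreGAGA1956, n° 13 Lemmes 4–5] J.-P. Serre, *Géométrie algébrique et géométrie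
  analytique*, Ann. Inst. Fourier 6 (1956) 1–42.
* [cite: SerreFAC1955, n° 65] J.-P. Serre, *Faisceaux algébriques cohérents*, Ann. of Math. 61
  (1955) 197–278.
-/

noncomputable section

open CategoryTheory CategoryTheory.Limits Set Filter
open scoped Topology

namespace Literature.AlgebraicGeometry.HodgeTheory

namespace GAGATwist

open Literature.Algebra.Homology Literature.Algebra.Homology.LaurentCech
  Literature.Analysis.Complex.LaurentSeparation

variable {r : ℕ}

/-- **The GAGA isomorphism on Čech cohomology for `𝒪(n)` on `ℙ_r(ℂ)`**: the map
`Ȟ^q(𝔘, 𝒪(n)) → Ȟ^q(𝔘^h, 𝒪(n)^h)` induced by `cechComparison r n` is an isomorphism, for every `q`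
(use `asIso (HomologicalComplex.homologyMap (cechComparison r n) q)` for the isomorphism itself).
[cite: SerreGAGA1956, n° 13 Lemme 5] -/
theorem isIso_homologyMap_cechComparison (n q : ℤ) :
    IsIso (HomologicalComplex.homologyMap (cechComparison r n) q) := by
  haveI := quasiIso_cechComparison (r := r) n
  infer_instance

/-- **`Ȟ^q(𝔘^h, 𝒪(n)^h) = 0` for `0 < q < r`** on `ℙ_r(ℂ)` (holomorphic Čech cohomology of the
standard cover). [cite: SerreGAGA1956, n° 13 Lemme 5] [cite: SerreFAC1955, n° 65] -/
theorem isZero_homology_holCech_of_lt (n : ℤ) {q : ℤ} (hq : 0 < q) (hqr : q < r) :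
    IsZero ((holCech r n).homology q) := by
  obtain ⟨p, rfl⟩ : ∃ p, q = p + 1 := ⟨q - 1, by ring⟩
  haveI := isIso_homologyMap_cechComparison (r := r) n (p + 1)
  exact (isZero_homology_cech_top_of_lt (A := ℂ) (r := r) (fun _ : Unit => (0 : ℤ)) n p
    (by omega) hqr).of_iso
    (asIso (HomologicalComplex.homologyMap (cechComparison r n) (p + 1))).symm

/-- **`Ȟ^q(𝔘^h, 𝒪(n)^h) = 0` for `q > r`** on `ℙ_r(ℂ)`. [cite: SerreGAGA1956, n° 13 Lemme 5] -/
theorem isZero_homology_holCech_of_gt (n : ℤ) {q : ℤ} (hq : (r : ℤ) < q) :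
    IsZero ((holCech r n).homology q) := by
  haveI := isIso_homologyMap_cechComparison (r := r) n q
  exact (isZero_homology_cech_of_lt (fun _ : Unit => (0 : ℤ)) (Ktop r) n q hq).of_iso
    (asIso (HomologicalComplex.homologyMap (cechComparison r n) q)).symm

/-- **Finiteness: `Ȟ^q(𝔘^h, 𝒪(n)^h)` is a finite-dimensional `ℂ`-vector space for every `q`** on
`ℙ_r(ℂ)` (Cartan–Serre finiteness for the twisting sheaves, via GAGA and Serre's algebraic
computation: `q ≥ 1` free-module Čech cohomology, `q = 0` Serre's `H⁰` finiteness, `q < 0` zero).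
[cite: SerreGAGA1956, n° 13 Lemme 5] [cite: SerreFAC1955, n° 65] -/
theorem moduleFinite_homology_holCech (n q : ℤ) : Module.Finite ℂ ((holCech r n).homology q) := by
  haveI : Module.Finite ℂ ((LaurentCech.cech (fun _ : Unit => (0 : ℤ)) (Ktop r) n).homology q) := by
    rcases lt_trichotomy q 0 with hq | rfl | hq
    · exact moduleFinite_homology_cech_of_neg (fun _ : Unit => (0 : ℤ)) (Ktop r) n q hq
    · exact moduleFinite_homology_cech_zero (fun _ : Unit => (0 : ℤ)) (Ktop r) n
    · exact moduleFinite_homology_cech_top (A := ℂ) (r := r) (fun _ : Unit => (0 : ℤ)) n q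
        (by omega)
  haveI := isIso_homologyMap_cechComparison (r := r) n q
  exact Module.Finite.equiv
    (asIso (HomologicalComplex.homologyMap (cechComparison r n) q)).toLinearEquiv

/-! ### Faithfulness of the model: a member of `F_n(s)` determines its section over `U_s` -/

/-- **Uniqueness of the holomorphic witness**: two functions continuous on the cone `Û_s` which
agree on the torus agree on all of `Û_s` (the torus is dense, `GAGATwist.dense_torus`). Hence a
member of `F_n(s) = holFamily r n s` determines the holomorphic function on `Û_s`, homogeneous
of degree `n`, that it represents — its section of `𝒪(n)^h` over `U_s` (Serre n° 16) — uniquely,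
and `s ↦ F_n(s)` with the inclusions IS the Čech system `s ↦ Γ(U_s^h, 𝒪(n)^h)` with its
restriction maps. [cite: SerreGAGA1956, n° 16] -/
theorem eqOn_coordCone_of_eqOn_torus {s : Finset (Fin (r + 1))} {g₁ g₂ : (Fin (r + 1) → ℂ) → ℂ}
    (h₁ : ContinuousOn g₁ (coordCone s)) (h₂ : ContinuousOn g₂ (coordCone s))
    (h : EqOn g₁ g₂ (torus r)) : EqOn g₁ g₂ (coordCone s) := by
  intro x hx
  have ht : Tendsto (fill x) (𝓝[≠] 0) (𝓝[coordCone s] x) :=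
    tendsto_nhdsWithin_iff.2 ⟨tendsto_fill x, eventually_mem_nhdsWithin.mono fun t ht =>
      torus_subset_coordCone s (fill_mem_torus x (mem_compl_singleton_iff.1 ht))⟩
  have heq : g₁ ∘ fill x =ᶠ[𝓝[≠] 0] g₂ ∘ fill x :=
    eventually_mem_nhdsWithin.mono fun t ht =>
      h (fill_mem_torus x (mem_compl_singleton_iff.1 ht))
  exact tendsto_nhds_unique_of_eventuallyEq ((h₁ x hx).tendsto.comp ht)
    ((h₂ x hx).tendsto.comp ht) heq

/-- **The two holomorphic witnesses of a member of `F_n(s)` agree on `Û_s`.**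
[cite: SerreGAGA1956, n° 16] -/
theorem eqOn_of_witnesses {s : Finset (Fin (r + 1))} {f : holTorus r}
    {g₁ g₂ : (Fin (r + 1) → ℂ) → ℂ} (h₁ : DifferentiableOn ℂ g₁ (coordCone s))
    (e₁ : EqOn (f : (Fin (r + 1) → ℂ) → ℂ) g₁ (torus r)) (h₂ : DifferentiableOn ℂ g₂ (coordCone s))
    (e₂ : EqOn (f : (Fin (r + 1) → ℂ) → ℂ) g₂ (torus r)) : EqOn g₁ g₂ (coordCone s) :=
  eqOn_coordCone_of_eqOn_torus h₁.continuousOn h₂.continuousOn fun x hx => by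
    rw [← e₁ hx, ← e₂ hx]

/-! ### Lemme 4 in cocycle form: `H⁰(𝔘^h, 𝒪(n)^h)` = homogeneous polynomials of degree `n` -/

/-- A polynomial whose Laurent image has negative degree is zero. [cite: SerreFAC1955, n° 64] -/
theorem eq_zero_of_toL_mem_Ldeg_of_neg {n : ℤ} (hn : n < 0) {p : P ℂ r}
    (hp : toL ℂ r p ∈ Ldeg ℂ r n) : p = 0 := by
  rw [mem_Ldeg] at hp
  ext m
  rw [MvPolynomial.coeff_zero]
  by_contra h
  have h1 := hp (castExp r m) (by rwa [coeff_toL_castExp])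
  rw [edeg_castExp] at h1
  have : (0 : ℤ) ≤ (m.degree : ℤ) := Int.natCast_nonneg _
  omega

/-- **Serre's Lemme 4, cocycle form: `H⁰(𝔘^h, 𝒪(n)^h)` consists of the homogeneous polynomials of
degree `n`.** For `r ≥ 1`, a holomorphic `0`-cocycle of `𝒪(n)^h` on the standard cover of `ℙ_r(ℂ)`
— sections `f_i ∈ Γ(U_i^h, 𝒪(n)^h)` agreeing on the overlaps — consists of the restrictions of ONE
polynomial `p` with `toL p ∈ L_n`, i.e. `p` homogeneous of degree `n`
(`LaurentCech.toL_mem_Ldeg_iff`) and `p = 0` if `n < 0` (`eq_zero_of_toL_mem_Ldeg_of_neg`).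
Proof: by the degree-`0` case of the cone-retraction criterion every `f_i` is algebraic, a Laurent
polynomial of degree `n` with poles only along `x_i`; all `f_i` are the same element of `𝕂`, so it
has no poles at all.
[cite: SerreGAGA1956, n° 13 Lemme 4] -/
theorem exists_mvPolynomial_of_d_zero_eq_zero (hr : 1 ≤ r) {n : ℤ}
    (c : OrderedCech.Cochain (holFamily r n) 0)
    (hc : OrderedCech.d (holFamily r n) (holFamily_mono n) 0 c = 0) :
    ∃ p : P ℂ r, toL ℂ r p ∈ Ldeg ℂ r n ∧
      ∀ i, ((c (OrderedCech.vertex i) : holFamily r n (OrderedCech.vertex i).1) : holTorus r) =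
        holEval r (toL ℂ r p) := by
  have hGF := algFamily_le_holFamily (r := r) n
  obtain ⟨g, -, hg⟩ := OrderedCech.exists_map_eq_of_coneRetraction_zero (holFamily_mono n)
    (algFamily_mono n) hGF (Top r) id (πop r) (fun k s => Top_mem_holFamily n k s)
    (πop_mem_algFamily n) (fun s _ f _ => sum_Top_add_πop_apply f) (holFamily_empty_le n) c hc
  have hval : ∀ i, ((c (OrderedCech.vertex i) : holFamily r n (OrderedCech.vertex i).1) :
      holTorus r) = ((g (OrderedCech.vertex i) : algFamily r n (OrderedCech.vertex i).1) :
        holTorus r) := by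
    intro i
    rw [← hg, OrderedCech.Cochain.coe_map_apply, LinearMap.id_apply]
  have hmem : ∀ i, ((g (OrderedCech.vertex i) : algFamily r n (OrderedCech.vertex i).1) :
      holTorus r) ∈ algFamily r n {i} := fun i => (g (OrderedCech.vertex i)).2
  have heq := (OrderedCech.d_zero_eq_zero_iff (holFamily r n) (holFamily_mono n) c).1 hc
  set j : Fin (r + 1) := ⟨1, by omega⟩ with hj
  have hj0 : (0 : Fin (r + 1)) ≠ j := by
    intro h; have := congrArg Fin.val h; rw [hj] at this; simp at this
  obtain ⟨v₀, hv₀, h₀⟩ := hmem 0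
  obtain ⟨v₁, hv₁, h₁⟩ := hmem j
  obtain ⟨⟨N₀, p₀, hp₀⟩, hdeg₀⟩ := exists_of_mem_locDeg hv₀
  obtain ⟨⟨N₁, p₁, hp₁⟩, -⟩ := exists_of_mem_locDeg hv₁
  have hw : v₁ () = v₀ () := holEval_injective (by
    rw [← ψ_apply, ← ψ_apply, h₁, h₀, ← hval, ← hval, heq])
  have key : ∀ m, (v₀ ()).coeff m ≠ 0 → ∀ i, 0 ≤ m i := by
    intro m hm i
    by_cases hi : i = 0
    · subst hi
      rw [← hw] at hm
      have hb := le_of_xs_mul_eq_toL hp₁ hm 0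
      rw [sx_apply, if_neg (by rwa [Finset.mem_singleton]), neg_zero] at hb
      exact hb
    · have hb := le_of_xs_mul_eq_toL hp₀ hm i
      rw [sx_apply, if_neg (by rwa [Finset.mem_singleton]), neg_zero] at hb
      exact hb
  obtain ⟨p, hp⟩ := exists_toL_eq_of_nonneg key
  refine ⟨p, by rw [hp]; exact hdeg₀, fun i => ?_⟩
  rw [heq i 0, hval 0, ← h₀, ψ_apply, hp]

/-- **Uniqueness in Lemme 4**: the polynomial representing a holomorphic `0`-cocycle is unique.
[cite: SerreGAGA1956, n° 13 Lemme 4] -/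
theorem toL_injective_holEval {p q : P ℂ r} (h : holEval r (toL ℂ r p) = holEval r (toL ℂ r q)) :
    p = q :=
  toL_injective (holEval_injective h)


end GAGATwist

end Literature.AlgebraicGeometry.HodgeTheory
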